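import Summits.Schanuel.Schanuel.Theorems.ZilberEacRationalAsymptote
import Summits.Schanuel.Schanuel.Theorems.ZilberEacNewtonBranch
import HarnessLib

/-!
# Arbitrary base branches, LXVIII (c): example — the cubic `(x₁ - x₀)(x₁ - 2x₀)(x₁ - 3x₀) = 1`,
# all of whose branches at infinity have RATIONAL real directions

HONEST FRAMING.  Cell `pub-schanuel` (Zilber's Exponential-Algebraic Closedness, case ladder;
host summit Schanuel), seat 2, gen 31.  The curve `C : (x₁ - x₀)(x₁ - 2x₀)(x₁ - 3x₀) = 1` is
irreducible (a root `a(x₀)` would make `a - x₀` and `a - 2x₀` units), monic of `x₁`-degree `3`,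
and its three branches at `x₀ = ∞` are asymptotic to the lines `x₁ = jx₀` (`j = 1, 2, 3`): every
direction is rational and real, so the growth method (files XIX–LXV) is silent on EVERY branch and
there is no bounded branch.  Along `x₁ ~ x₀`: with `x₀ = 1/s` and `x₁ = 1/s + t` the equation
becomes `G(s, t) = s²t³ - 3st² + 2t - s² = 0`, `G(0, 0) = 0`, `∂_tG(0, 0) = 2 ≠ 0`, so
`t = γ(s)` is analytic (implicit function theorem, file `NewtonBranch`) and `x₁ - x₀ = γ(s)` is
bounded: file LXVIII (b) with `U = (1 0; -1 1)` gives
**`unprojectedDensityQuestion_threeLinesCubic_polyFibre`** — for every `R` nonzero somewhere on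
`C`, `{C, y₀ = R}` is in Mantova–Masser's case and has Zariski-dense exponential points.
Decided instances of an OPEN question (Mantova–Masser, PLMS 2024 §1 p. 5); EC(3,2) OPEN; NOT
Schanuel's conjecture (neither used nor implied); EAC ⇏ SC.
-/

noncomputable section

open Filter Topology Set Complex Polynomial
open Literature.NumberTheory.Transcendental Literature.ModelTheory.Zilber
open Literature.ModelTheory.ExponentialFields

set_option linter.dupNamespace false

namespace Summit.Schanuel.Schanuel.Theorems

section ThreeLines

/-- The cubic `(x₁ - x₀)(x₁ - 2x₀)(x₁ - 3x₀) - 1 ∈ ℂ[x₀][x₁]`. -/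
private theorem threeLines_eval (x y : ℂ) :
    (((X - Polynomial.C (X : ℂ[X])) * (X - Polynomial.C (2 * X : ℂ[X])) *
        (X - Polynomial.C (3 * X : ℂ[X])) - 1 : ℂ[X][X]).map (Polynomial.evalRingHom x)).eval y =
      (y - x) * (y - 2 * x) * (y - 3 * x) - 1 := by
  simp

/-- Auxiliary computation for the example (`threeLines_monic`). [folklore] -/
private theorem threeLines_monic :
    ((X - Polynomial.C (X : ℂ[X])) * (X - Polynomial.C (2 * X : ℂ[X])) *
        (X - Polynomial.C (3 * X : ℂ[X])) - 1 : ℂ[X][X]).Monic := by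
  have h3 : ((X - Polynomial.C (X : ℂ[X])) * (X - Polynomial.C (2 * X : ℂ[X])) *
      (X - Polynomial.C (3 * X : ℂ[X])) : ℂ[X][X]).Monic :=
    ((Polynomial.monic_X_sub_C _).mul (Polynomial.monic_X_sub_C _)).mul (Polynomial.monic_X_sub_C _)
  refine h3.sub_of_left ?_
  rw [Polynomial.degree_one, Polynomial.degree_mul, Polynomial.degree_mul, Polynomial.degree_X_sub_C,
    Polynomial.degree_X_sub_C, Polynomial.degree_X_sub_C]
  norm_num

/-- Auxiliary computation for the example (`threeLines_natDegree`). [folklore] -/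
private theorem threeLines_natDegree :
    ((X - Polynomial.C (X : ℂ[X])) * (X - Polynomial.C (2 * X : ℂ[X])) *
        (X - Polynomial.C (3 * X : ℂ[X])) - 1 : ℂ[X][X]).natDegree = 3 := by
  have h3 : ((X - Polynomial.C (X : ℂ[X])) * (X - Polynomial.C (2 * X : ℂ[X])) *
      (X - Polynomial.C (3 * X : ℂ[X])) : ℂ[X][X]).natDegree = 3 := by
    rw [Polynomial.natDegree_mul (mul_ne_zero (Polynomial.X_sub_C_ne_zero _) (Polynomial.X_sub_C_ne_zero _))
      (Polynomial.X_sub_C_ne_zero _), Polynomial.natDegree_mul (Polynomial.X_sub_C_ne_zero _)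
      (Polynomial.X_sub_C_ne_zero _), Polynomial.natDegree_X_sub_C (Polynomial.X : ℂ[X]),
      Polynomial.natDegree_X_sub_C (2 * Polynomial.X : ℂ[X]), Polynomial.natDegree_X_sub_C (3 * Polynomial.X : ℂ[X])]
  rw [Polynomial.natDegree_sub_eq_left_of_natDegree_lt (by rw [h3, Polynomial.natDegree_one]; norm_num),
    h3]

/-- `(x₁ - x₀)(x₁ - 2x₀)(x₁ - 3x₀) - 1` is irreducible: a root `a ∈ ℂ[x₀]` would make
`a - x₀` and `a - 2x₀` units of `ℂ[x₀]`, so `x₀` would be constant. [folklore] -/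
private theorem threeLines_irreducible :
    Irreducible ((X - Polynomial.C (X : ℂ[X])) * (X - Polynomial.C (2 * X : ℂ[X])) *
        (X - Polynomial.C (3 * X : ℂ[X])) - 1 : ℂ[X][X]) := by
  rw [threeLines_monic.irreducible_iff_roots_eq_zero_of_degree_le_three
    (by rw [threeLines_natDegree]; norm_num) (by rw [threeLines_natDegree]),
    Multiset.eq_zero_iff_forall_notMem]
  intro a ha
  rw [Polynomial.mem_roots threeLines_monic.ne_zero, Polynomial.IsRoot] at ha
  simp only [Polynomial.eval_sub, Polynomial.eval_mul, Polynomial.eval_X, Polynomial.eval_C,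
    Polynomial.eval_one, sub_eq_zero] at ha
  -- `(a - X)` is a unit
  have hu1 : IsUnit (a - X) :=
    IsUnit.of_mul_eq_one ((a - 2 * X) * (a - 3 * X)) (by rw [← mul_assoc]; exact ha)
  have hu2 : IsUnit (a - 2 * X) := by
    refine IsUnit.of_mul_eq_one ((a - X) * (a - 3 * X)) ?_
    linear_combination ha
  have h1 := Polynomial.natDegree_eq_zero_of_isUnit hu1
  have h2 := Polynomial.natDegree_eq_zero_of_isUnit hu2
  have hX : ((a - X) - (a - 2 * X) : ℂ[X]) = X := by ring
  have hdeg : (X : ℂ[X]).natDegree ≤ 0 := by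
    rw [← hX]
    refine (Polynomial.natDegree_sub_le _ _).trans ?_
    rw [h1, h2]; simp
  rw [Polynomial.natDegree_X] at hdeg
  exact Nat.not_succ_le_zero 0 hdeg

/-- **`{(x₁ - x₀)(x₁ - 2x₀)(x₁ - 3x₀) = 1, y₀ = R(x₀, x₁)}`: case ∧ dense for every `R` nonzero
somewhere on the curve** — by the rational-asymptote transport along the branch `x₁ - x₀ → 0`.
[cite: MantovaMasser2023, §1 Further remarks, p. 5 (the question, open in general)] (new) -/
theorem unprojectedDensityQuestion_threeLinesCubic_polyFibre (R : MvPolynomial (Fin 2) ℂ)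
    (hR : ∃ x y : ℂ, (y - x) * (y - 2 * x) * (y - 3 * x) - 1 = 0 ∧ MvPolynomial.eval ![x, y] R ≠ 0) :
    MMCaseDimPiOneFree {w : Fin 2 ⊕ Fin 2 → ℂ |
        (w (Sum.inl 1) - w (Sum.inl 0)) * (w (Sum.inl 1) - 2 * w (Sum.inl 0)) *
          (w (Sum.inl 1) - 3 * w (Sum.inl 0)) - 1 = 0 ∧
        w (Sum.inr 0) = MvPolynomial.eval ![w (Sum.inl 0), w (Sum.inl 1)] R} ∧
      UnprojectedDense {w : Fin 2 ⊕ Fin 2 → ℂ |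
        (w (Sum.inl 1) - w (Sum.inl 0)) * (w (Sum.inl 1) - 2 * w (Sum.inl 0)) *
          (w (Sum.inl 1) - 3 * w (Sum.inl 0)) - 1 = 0 ∧
        w (Sum.inr 0) = MvPolynomial.eval ![w (Sum.inl 0), w (Sum.inl 1)] R} := by
  classical
  set F : ℂ[X][X] := (X - Polynomial.C (X : ℂ[X])) * (X - Polynomial.C (2 * X : ℂ[X])) *
    (X - Polynomial.C (3 * X : ℂ[X])) - 1 with hF
  have hset : {w : Fin 2 ⊕ Fin 2 → ℂ |
      (w (Sum.inl 1) - w (Sum.inl 0)) * (w (Sum.inl 1) - 2 * w (Sum.inl 0)) *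
        (w (Sum.inl 1) - 3 * w (Sum.inl 0)) - 1 = 0 ∧
      w (Sum.inr 0) = MvPolynomial.eval ![w (Sum.inl 0), w (Sum.inl 1)] R} =
      {w : Fin 2 ⊕ Fin 2 → ℂ |
        (F.map (Polynomial.evalRingHom (w (Sum.inl 0)))).eval (w (Sum.inl 1)) = 0 ∧
        w (Sum.inr 0) = MvPolynomial.eval ![w (Sum.inl 0), w (Sum.inl 1)] R} := by
    ext w; simp only [Set.mem_setOf_eq, hF, threeLines_eval]
  rw [hset]
  -- the analytic branch `t = γ(s)` of `G(s, t) = s²t³ - 3st² + 2t - s² = 0` at `(0, 0)`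
  set G : ℂ[X][X] := Polynomial.C (X ^ 2 : ℂ[X]) * X ^ 3 - Polynomial.C (3 * X : ℂ[X]) * X ^ 2 +
    2 * X - Polynomial.C (X ^ 2 : ℂ[X]) with hG
  have hGev : ∀ s t : ℂ, (G.map (Polynomial.evalRingHom s)).eval t =
      s ^ 2 * t ^ 3 - 3 * s * t ^ 2 + 2 * t - s ^ 2 := by
    intro s t; simp [hG]
  have hroot : (G.map (Polynomial.evalRingHom 0)).IsRoot 0 := by
    rw [Polynomial.IsRoot, hGev]; norm_num
  have hder : ¬ ((derivative G).map (Polynomial.evalRingHom 0)).IsRoot 0 := by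
    rw [Polynomial.IsRoot, hG]
    simp [Polynomial.derivative_pow]
  obtain ⟨γ, hγan, hγ0, hγroot⟩ := exists_branchAt G hroot hder
  -- the place `x₀ = s^{-1}`, `x₁ = s^{-1} + γ(s)`
  set X₁ : ℂ → ℂ := fun s => (s ^ 1)⁻¹ + γ s with hX₁
  have hplace : ∀ᶠ s in 𝓝[≠] (0 : ℂ), (F.map (Polynomial.evalRingHom (s ^ 1)⁻¹)).eval (X₁ s) = 0 := by
    filter_upwards [nhdsWithin_le_nhds hγroot, self_mem_nhdsWithin] with s hs (hs0 : s ≠ 0)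
    rw [hGev] at hs
    rw [hF, threeLines_eval, hX₁]
    simp only [pow_one]
    have hid : (s⁻¹ + γ s - s⁻¹) * (s⁻¹ + γ s - 2 * s⁻¹) * (s⁻¹ + γ s - 3 * s⁻¹) - 1 =
        (s ^ 2)⁻¹ * (s ^ 2 * γ s ^ 3 - 3 * s * γ s ^ 2 + 2 * γ s - s ^ 2) := by
      field_simp
      ring
    rw [hid, hs, mul_zero]
  -- the lattice change `U = (1 0; -1 1)`, `V = (1 0; 1 1)`
  set U : Matrix (Fin 2) (Fin 2) ℤ := !![1, 0; -1, 1] with hU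
  set V : Matrix (Fin 2) (Fin 2) ℤ := !![1, 0; 1, 1] with hV
  have hUV : U * V = 1 := by rw [hU, hV]; decide
  have hVU : V * U = 1 := by rw [hU, hV]; decide
  have hq : U 1 1 ≠ 0 := by rw [hU]; decide
  have hγ' : ∀ᶠ s in 𝓝[≠] (0 : ℂ), (U 1 0 : ℂ) * (s ^ 1)⁻¹ + (U 1 1 : ℂ) * X₁ s = γ s := by
    filter_upwards [self_mem_nhdsWithin] with s (hs0 : s ≠ 0)
    simp [hU, hX₁]
  refine unprojectedDensityQuestion_planeCurve_polyFibre_rationalAsymptote F threeLines_irreducible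
    (by rw [threeLines_natDegree]; norm_num) U V hUV hVU hq le_rfl hγan hγ' hplace R ?_
  obtain ⟨x, y, hxy, hne⟩ := hR
  exact ⟨x, y, by rw [hF, threeLines_eval]; exact hxy, hne⟩

/-- **`{(x₁ - x₀)(x₁ - 2x₀)(x₁ - 3x₀) = 1, y₀ = x₀}`: case ∧ dense.** [cite: MantovaMasser2023,
§1 Further remarks, p. 5 (the question, open in general)] (new) -/
theorem unprojectedDensityQuestion_threeLinesCubic_fibre_x₀ :
    MMCaseDimPiOneFree {w : Fin 2 ⊕ Fin 2 → ℂ |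
        (w (Sum.inl 1) - w (Sum.inl 0)) * (w (Sum.inl 1) - 2 * w (Sum.inl 0)) *
          (w (Sum.inl 1) - 3 * w (Sum.inl 0)) - 1 = 0 ∧ w (Sum.inr 0) = w (Sum.inl 0)} ∧
      UnprojectedDense {w : Fin 2 ⊕ Fin 2 → ℂ |
        (w (Sum.inl 1) - w (Sum.inl 0)) * (w (Sum.inl 1) - 2 * w (Sum.inl 0)) *
          (w (Sum.inl 1) - 3 * w (Sum.inl 0)) - 1 = 0 ∧ w (Sum.inr 0) = w (Sum.inl 0)} := by
  -- the point `(x, y) = (-1, 0)`: `(0 + 1)(0 + 2)(0 + 3) - 1 = 5 ≠ 0`; use instead `x` with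
  -- `(y - x)(y - 2x)(y - 3x) = 1` at `y = 0`: `-6x³ = 1`, any cube root.
  obtain ⟨x, hx⟩ := IsAlgClosed.exists_pow_nat_eq (-(1 : ℂ) / 6) (by norm_num : 0 < 3)
  have h := unprojectedDensityQuestion_threeLinesCubic_polyFibre (MvPolynomial.X 0)
    ⟨x, 0, by linear_combination (-6 : ℂ) * hx, by
      simp only [MvPolynomial.eval_X, Matrix.cons_val_zero, ne_eq]
      rintro rfl
      norm_num at hx⟩
  simpa only [MvPolynomial.eval_X, Matrix.cons_val_zero] using h

end ThreeLines

end Summit.Schanuel.Schanuel.Theorems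

end
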